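import Summits.QuantumFields.BalabanUV.T4Continuum.Support.SubstrateChartSection
import Literature.MathematicalPhysics.QuantumFieldTheory.Balaban1983to89.B7BlockAvgLog

/-!
# SUBSTRATE — THE LOGARITHMIC CHART OF `expChartT`: the explicit local inverse of `A ↦ e^{A}·R⁰` at a tower `R⁰` of invertible
# transporters, `logChartT R⁰ T k ν i := log (T k ν i · (R⁰ k ν i)⁻¹)` with `log` = the series (21) `MatrixLog.mlog`
# (piece (C) of the L-E18 scoping page `substrate/p4/SCOPE-L-E18-towerDataOfC.md` v1.1; credit p2 g6's pointer F1)

Cell `pub-balaban`, SUBSTRATE cell, seat `b2b-balaban-substrate-p4` (gen 5).  Summits-side under the LEAN PLACEMENT RULE.  HONEST FRAMING: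
rung (B)+1 of the FINITE-VOLUME T⁴ programme — NOT infinite volume, NOT a mass gap, NOT Clay; spine PROVED 0∕9.  [folklore] CHART
BOOKKEEPING ONLY: nothing of [Balaban1985Averaging] ∕ [Balaban1987RG1] is asserted; NO estimate of any NE row.  NORM OF RECORD (typer
ruling Q-S13): the chart space carries the Pi-sup norm over Mathlib's scoped `Matrix.Norms.L2Operator` instances, as in
`SubstrateTransporterSpeciesHolo`.  HONEST DEPENDENCY (cell line, verbatim): continuum YM on T⁴ ⇐ BetaPertH ∧ nine spine estimates (0/9
proved); BetaPertH ⇐ (D1) ∧ (D4) ∧ CAP+tail; G-an2-4 gates asym, D1 and NE2/3/4.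

NOT A DUPLICATE (typer check (ο9-2)(b)): `SubstrateTransporterSpeciesHolo.expChartInvT R⁰ A = (R⁰)⁻¹·e^{−A}` (l.248) is the chart of
the INVERSE transporters, not a logarithm; no `log`-chart of `expChartT` existed.  Typer ruling (ο9-2)(b): L-E18a = W-24a → p4 g5; riders
(α‴) radii as LITERALS in `TowerData` currency, (β‴) imports, (γ‴) ≤ 250 l., definition lane.  Co-credit: p2 g6's pointer F1 (l.22533)
and draft `substrate/p2/SubstrateExpChartLog.draft-unfiled.lean` (sup-norm form and whole-map analyticity adopted from it).

WHAT (imports, per rider (β‴)′ l.22611: substrate `SubstrateChartSection` (p224186; re-exports `SubstrateTransporterSpeciesHolo` and supplies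
the entry-projection analyticity `analyticAt_apply`) + Literature `B7BlockAvgLog` (for `mlog_exp`; re-exports `MatrixLog`: `mlog`, `exp_mlog`,
`analyticAt_mlog`, `norm_mlog_le_two_mul`) ONLY; nothing existing is modified):
* §1 one level: `logChart R₀ T ν i := mlog (T ν i * (R₀ ν i)⁻¹)`; `logChart_self` (`= 0` at `T = R₀`), **`expChart_logChart`**
  (`expChart R₀ (logChart R₀ T) = T` when every `‖T ν i·(R₀ ν i)⁻¹ − 1‖ < 1`), **`logChart_expChart`** (`logChart R₀ (expChart R₀ A) = A`
  when every `‖A ν i‖ < log 2`), the norm control `norm_logChart_apply_le` (`≤ 2‖T ν i·(R₀ ν i)⁻¹ − 1‖` on the half ball) and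
  entrywise analyticity `analyticAt_logChart_apply` along any analytic family of transporters.
* §2 the tower: `logChartT R₀ T k := logChart (R₀ k) (T k)` with the same facts (`logChartT_self`, **`expChartT_logChartT`**,
  **`logChartT_expChartT`**, `norm_logChartT_apply_le`, sup form `norm_logChartT_le`, `analyticAt_logChartT_apply`) + their forms at a
  UNITARY centre (`…_of_unitary`, via `SubstrateTransporterSpecies.isUnit_det_of_mem_unitaryGroup`) + WHOLE-MAP analyticity
  `analyticAt_logChartT` ∕ `analyticOnNhd_logChartT` on the log window `{T | ∀ k ν i, ‖T k ν i·(R₀ k ν i)⁻¹ − 1‖ < 1}`, at the centre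
  itself (`norm_centre_window_lt_one`, `analyticAt_logChartT_centre`), and `analyticAt_logChartT_comp` along an analytic family `z ↦ T z`
  (the shape L-E18b's slices take); and, at a UNITARY centre, the passage from the Pi-sup ball to the log window:
  `norm_mul_inv_sub_one_le` (`‖T·U⁻¹ − 1‖ ≤ ‖T − U‖`), `mem_logWindow_of_norm_sub_lt_one` (`ball R₀ 1 ⊆` window), **`norm_logChartT_le_two_mul_norm_sub`**
  (`‖T − R₀‖ ≤ 1∕2 ⇒ ‖logChartT P R₀ T‖ ≤ 2‖T − R₀‖` — the depth-control letter) and `analyticOnNhd_logChartT_ball`.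
-/

noncomputable section

open scoped BigOperators Matrix Matrix.Norms.L2Operator
open NormedSpace

namespace Summit.QuantumFields.BalabanUV.T4Continuum.SubstrateExpChartLog

open Literature.MathematicalPhysics.QuantumFieldTheory.Balaban1983to89
open Literature.MathematicalPhysics.QuantumFieldTheory.Balaban1983to89.B5Prop11Plancherel (Tor fine)
open Literature.MathematicalPhysics.QuantumFieldTheory.Balaban1983to89.B5G183RateUnitTower (lev)
open Summit.QuantumFields.BalabanUV.T4Continuum.SubstrateBackgroundTransporters (unitMod)
open Literature.MathematicalPhysics.QuantumFieldTheory.Balaban1983to89.MatrixLog (mlog mlog_one exp_mlog analyticAt_mlog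
  norm_mlog_le_two_mul)
open Literature.MathematicalPhysics.QuantumFieldTheory.Balaban1983to89.B7BlockAvgLog (mlog_exp)
open Summit.QuantumFields.BalabanUV.T4Continuum.SubstrateTransporterSpecies (expChart expChart_apply TowerData isUnit_det_of_mem_unitaryGroup)
open Summit.QuantumFields.BalabanUV.T4Continuum.SubstrateTransporterSpeciesHolo (expChartT expChartT_apply)

/-! ## §1 One level -/

section OneLevel

variable {d : ℕ} {ι : Type*} {o : Type*} [Fintype o] [DecidableEq o]

/-- [folklore] **THE LOGARITHMIC CHART AT `R⁰`** (one level): `logChart R₀ T ν i := log (T ν i · (R₀ ν i)⁻¹)`, `log` = `MatrixLog.mlog`. -/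
def logChart (R₀ T : Fin d → ι → Matrix o o ℂ) : Fin d → ι → Matrix o o ℂ := fun ν i => mlog (T ν i * (R₀ ν i)⁻¹)

/-- [folklore] `logChart` unfolds. -/ @[simp] theorem logChart_apply (R₀ T : Fin d → ι → Matrix o o ℂ) (ν : Fin d) (i : ι) :
    logChart R₀ T ν i = mlog (T ν i * (R₀ ν i)⁻¹) := rfl

/-- [folklore] **THE CHART IS CENTRED**: `logChart R₀ R₀ = 0` when every `R₀ ν i` is invertible. -/
theorem logChart_self {R₀ : Fin d → ι → Matrix o o ℂ} (hR : ∀ ν i, IsUnit (R₀ ν i).det) : logChart R₀ R₀ = 0 := by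
  funext ν i
  rw [logChart_apply, Matrix.mul_nonsing_inv _ (hR ν i), mlog_one, Pi.zero_apply, Pi.zero_apply]

/-- [folklore] **`exp ∘ log = id` ON THE CHART**: `expChart R₀ (logChart R₀ T) = T` whenever every `R₀ ν i` is invertible and every
`‖T ν i·(R₀ ν i)⁻¹ − 1‖ < 1` (`MatrixLog.exp_mlog`). -/
theorem expChart_logChart {R₀ T : Fin d → ι → Matrix o o ℂ} (hR : ∀ ν i, IsUnit (R₀ ν i).det)
    (hT : ∀ ν i, ‖T ν i * (R₀ ν i)⁻¹ - 1‖ < 1) : expChart R₀ (logChart R₀ T) = T := by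
  funext ν i
  rw [expChart_apply, logChart_apply, exp_mlog (hT ν i), Matrix.nonsing_inv_mul_cancel_right _ _ (hR ν i)]

/-- [folklore] **`log ∘ exp = id` ON THE CHART**: `logChart R₀ (expChart R₀ A) = A` whenever every `R₀ ν i` is invertible and every
`‖A ν i‖ < log 2` (`B7BlockAvgLog.mlog_exp`). -/
theorem logChart_expChart {R₀ A : Fin d → ι → Matrix o o ℂ} (hR : ∀ ν i, IsUnit (R₀ ν i).det)
    (hA : ∀ ν i, ‖A ν i‖ < Real.log 2) : logChart R₀ (expChart R₀ A) = A := by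
  funext ν i
  rw [logChart_apply, expChart_apply, Matrix.mul_nonsing_inv_cancel_right _ _ (hR ν i), mlog_exp (hA ν i)]

/-- [folklore] **NORM CONTROL ON THE HALF BALL**: `‖logChart R₀ T ν i‖ ≤ 2·‖T ν i·(R₀ ν i)⁻¹ − 1‖` when the latter is `≤ 1∕2`
(`MatrixLog.norm_mlog_le_two_mul`, (26)). -/
theorem norm_logChart_apply_le {R₀ T : Fin d → ι → Matrix o o ℂ} {ν : Fin d} {i : ι} (h : ‖T ν i * (R₀ ν i)⁻¹ - 1‖ ≤ 1 / 2) :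
    ‖logChart R₀ T ν i‖ ≤ 2 * ‖T ν i * (R₀ ν i)⁻¹ - 1‖ := by
  rw [logChart_apply]; exact norm_mlog_le_two_mul h

/-- [folklore] **ENTRYWISE ANALYTICITY ALONG AN ANALYTIC FAMILY OF TRANSPORTERS**: if `x ↦ T x ν i` is analytic at `x₀` and
`‖T x₀ ν i·(R₀ ν i)⁻¹ − 1‖ < 1`, then `x ↦ logChart R₀ (T x) ν i` is analytic at `x₀` (`analyticAt_mlog` ∘ right multiplication). -/
theorem analyticAt_logChart_apply {E : Type*} [NormedAddCommGroup E] [NormedSpace ℂ E] {R₀ : Fin d → ι → Matrix o o ℂ}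
    {T : E → Fin d → ι → Matrix o o ℂ} {x₀ : E} {ν : Fin d} {i : ι} (hT : AnalyticAt ℂ (fun x => T x ν i) x₀)
    (h : ‖T x₀ ν i * (R₀ ν i)⁻¹ - 1‖ < 1) : AnalyticAt ℂ (fun x => logChart R₀ (T x) ν i) x₀ := by
  have hmul : AnalyticAt ℂ (fun x => T x ν i * (R₀ ν i)⁻¹) x₀ := hT.mul analyticAt_const
  exact (analyticAt_mlog h).comp_of_eq hmul rfl

end OneLevel

/-! ## §2 The tower -/

section Tower

variable (P : Params) {o : Type*} [Fintype o] [DecidableEq o]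

/-- [folklore] **THE LOGARITHMIC TOWER CHART AT `R⁰`**: `logChartT R₀ T k := logChart (R₀ k) (T k)` — the explicit local inverse of
`SubstrateTransporterSpeciesHolo.expChartT P R₀`. -/
def logChartT (R₀ T : TowerData P o) : TowerData P o := fun k => logChart (R₀ k) (T k)

/-- [folklore] `logChartT` unfolds. -/ @[simp] theorem logChartT_apply (R₀ T : TowerData P o) (k : Fin (P.K + 1)) : logChartT P R₀ T k = logChart (R₀ k) (T k) := rfl

/-- [folklore] The tower chart is centred: `logChartT R₀ R₀ = 0` at a tower of invertible transporters. -/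
theorem logChartT_self {R₀ : TowerData P o} (hR : ∀ k ν i, IsUnit (R₀ k ν i).det) : logChartT P R₀ R₀ = 0 := by
  funext k; rw [logChartT_apply, logChart_self (hR k), Pi.zero_apply]

/-- [folklore] **`expChartT ∘ logChartT = id`** on the towers `T` with every `‖T k ν i·(R₀ k ν i)⁻¹ − 1‖ < 1`. -/
theorem expChartT_logChartT {R₀ T : TowerData P o} (hR : ∀ k ν i, IsUnit (R₀ k ν i).det)
    (hT : ∀ k ν i, ‖T k ν i * (R₀ k ν i)⁻¹ - 1‖ < 1) : expChartT P R₀ (logChartT P R₀ T) = T := by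
  funext k; rw [expChartT_apply, logChartT_apply, expChart_logChart (hR k) (hT k)]

/-- [folklore] **`logChartT ∘ expChartT = id`** on the chart coordinates `A` with every `‖A k ν i‖ < log 2`. -/
theorem logChartT_expChartT {R₀ A : TowerData P o} (hR : ∀ k ν i, IsUnit (R₀ k ν i).det)
    (hA : ∀ k ν i, ‖A k ν i‖ < Real.log 2) : logChartT P R₀ (expChartT P R₀ A) = A := by
  funext k; rw [logChartT_apply, expChartT_apply, logChart_expChart (hR k) (hA k)]

/-- [folklore] Norm control on the half ball, entrywise. -/
theorem norm_logChartT_apply_le {R₀ T : TowerData P o} {k : Fin (P.K + 1)} {ν : Fin P.d}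
    {i : Tor (fine (lev P.L k) (unitMod P)) × Fin P.d} (h : ‖T k ν i * (R₀ k ν i)⁻¹ - 1‖ ≤ 1 / 2) :
    ‖logChartT P R₀ T k ν i‖ ≤ 2 * ‖T k ν i * (R₀ k ν i)⁻¹ - 1‖ := by
  rw [logChartT_apply]; exact norm_logChart_apply_le h

/-- [folklore] **ENTRYWISE ANALYTICITY OF THE TOWER CHART COORDINATE ALONG AN ANALYTIC FAMILY OF TOWERS** (e.g. a complex
one-parameter slice `z ↦ T z` of averaged transporters): `AnalyticAt ℂ (fun x => logChartT P R₀ (T x) k ν i) x₀`. -/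
theorem analyticAt_logChartT_apply {E : Type*} [NormedAddCommGroup E] [NormedSpace ℂ E] {R₀ : TowerData P o} {T : E → TowerData P o}
    {x₀ : E} {k : Fin (P.K + 1)} {ν : Fin P.d} {i : Tor (fine (lev P.L k) (unitMod P)) × Fin P.d}
    (hT : AnalyticAt ℂ (fun x => T x k ν i) x₀) (h : ‖T x₀ k ν i * (R₀ k ν i)⁻¹ - 1‖ < 1) :
    AnalyticAt ℂ (fun x => logChartT P R₀ (T x) k ν i) x₀ :=
  analyticAt_logChart_apply (R₀ := R₀ k) (T := fun x => T x k) hT h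

/-- [folklore] **NORM CONTROL, sup form** (adopted from p2 g6's draft): if every entry of `T·R₀⁻¹ − 1` has norm `≤ η` with `0 ≤ η ≤ 1∕2`, then
`‖logChartT P R₀ T‖ ≤ 2η` in the Pi-sup norm of record. -/
theorem norm_logChartT_le {R₀ T : TowerData P o} {η : ℝ} (hη0 : 0 ≤ η) (hη : η ≤ 1 / 2)
    (h : ∀ (k : Fin (P.K + 1)) ν i, ‖T k ν i * (R₀ k ν i)⁻¹ - 1‖ ≤ η) : ‖logChartT P R₀ T‖ ≤ 2 * η := by
  refine (pi_norm_le_iff_of_nonneg (by positivity)).2 fun k => (pi_norm_le_iff_of_nonneg (by positivity)).2 fun ν =>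
    (pi_norm_le_iff_of_nonneg (by positivity)).2 fun i => ?_
  exact (norm_logChartT_apply_le P ((h k ν i).trans hη)).trans (by linarith [h k ν i])

/-- [folklore] **WHOLE-MAP ANALYTICITY ON THE LOG WINDOW** (adopted from p2 g6's draft): `T ↦ logChartT P R₀ T` is analytic at every tower
`T₀` with `∀ k ν i, ‖T₀ k ν i·(R₀ k ν i)⁻¹ − 1‖ < 1` (entrywise `analyticAt_mlog` ∘ (`SubstrateChartSection.analyticAt_apply` · constant)). -/
theorem analyticAt_logChartT {R₀ T₀ : TowerData P o} (h : ∀ (k : Fin (P.K + 1)) ν i, ‖T₀ k ν i * (R₀ k ν i)⁻¹ - 1‖ < 1) :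
    AnalyticAt ℂ (fun T : TowerData P o => logChartT P R₀ T) T₀ := by
  refine analyticAt_pi_iff.2 fun k => analyticAt_pi_iff.2 fun ν => analyticAt_pi_iff.2 fun i => ?_
  exact analyticAt_logChart_apply (R₀ := R₀ k) (T := fun T : TowerData P o => T k) (SubstrateChartSection.analyticAt_apply P k ν i T₀) (h k ν i)

/-- [folklore] … hence `logChartT P R₀` is analytic on the log window of `R₀` as a set. -/
theorem analyticOnNhd_logChartT (R₀ : TowerData P o) :
    AnalyticOnNhd ℂ (fun T : TowerData P o => logChartT P R₀ T) {T | ∀ (k : Fin (P.K + 1)) ν i, ‖T k ν i * (R₀ k ν i)⁻¹ - 1‖ < 1} :=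
  fun _ hT => analyticAt_logChartT P hT

/-- [folklore] **ALONG AN ANALYTIC FAMILY OF TOWERS** (the shape L-E18b's complex slices take): if `z ↦ T z` is analytic at `z₀` as a map into
`TowerData P o` and `T z₀` lies in the log window of `R₀`, then `z ↦ logChartT P R₀ (T z)` is analytic at `z₀`. -/
theorem analyticAt_logChartT_comp {E : Type*} [NormedAddCommGroup E] [NormedSpace ℂ E] {R₀ : TowerData P o} {T : E → TowerData P o}
    {z₀ : E} (hT : AnalyticAt ℂ T z₀) (h : ∀ (k : Fin (P.K + 1)) ν i, ‖T z₀ k ν i * (R₀ k ν i)⁻¹ - 1‖ < 1) :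
    AnalyticAt ℂ (fun z => logChartT P R₀ (T z)) z₀ :=
  (analyticAt_logChartT P h).comp hT

/-- [folklore] The centre lies in its own log window: `‖R₀ k ν i·(R₀ k ν i)⁻¹ − 1‖ = 0 < 1` at a tower of invertible transporters. -/
theorem norm_centre_window_lt_one {R₀ : TowerData P o} (hR : ∀ (k : Fin (P.K + 1)) ν i, IsUnit (R₀ k ν i).det) (k : Fin (P.K + 1))
    (ν : Fin P.d) (i : Tor (fine (lev P.L k) (unitMod P)) × Fin P.d) : ‖R₀ k ν i * (R₀ k ν i)⁻¹ - 1‖ < 1 := by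
  rw [Matrix.mul_nonsing_inv _ (hR k ν i), sub_self, norm_zero]; exact one_pos

/-- [folklore] **THE LOG CHART IS ANALYTIC AT ITS CENTRE** (the point consumers expand around). -/
theorem analyticAt_logChartT_centre {R₀ : TowerData P o} (hR : ∀ (k : Fin (P.K + 1)) ν i, IsUnit (R₀ k ν i).det) :
    AnalyticAt ℂ (fun T : TowerData P o => logChartT P R₀ T) R₀ :=
  analyticAt_logChartT P (norm_centre_window_lt_one P hR)

/-! ### At a UNITARY centre (the towers of record `towerDataOf` of unitary configurations are such) -/
/-- [folklore] At a unitary centre every entry has an invertible determinant. -/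
theorem isUnit_det_of_unitary {R₀ : TowerData P o} (hR : ∀ (k : Fin (P.K + 1)) ν i, R₀ k ν i ∈ Matrix.unitaryGroup o ℂ)
    (k : Fin (P.K + 1)) (ν : Fin P.d) (i : Tor (fine (lev P.L k) (unitMod P)) × Fin P.d) : IsUnit (R₀ k ν i).det :=
  isUnit_det_of_mem_unitaryGroup (hR k ν i)

/-- [folklore] `logChartT_self` at a unitary centre. -/
theorem logChartT_self_of_unitary {R₀ : TowerData P o} (hR : ∀ (k : Fin (P.K + 1)) ν i, R₀ k ν i ∈ Matrix.unitaryGroup o ℂ) :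
    logChartT P R₀ R₀ = 0 :=
  logChartT_self P (isUnit_det_of_unitary P hR)

/-- [folklore] `expChartT_logChartT` at a unitary centre: the literal window `‖T k ν i·(R₀ k ν i)⁻¹ − 1‖ < 1`. -/
theorem expChartT_logChartT_of_unitary {R₀ T : TowerData P o} (hR : ∀ (k : Fin (P.K + 1)) ν i, R₀ k ν i ∈ Matrix.unitaryGroup o ℂ)
    (hT : ∀ (k : Fin (P.K + 1)) ν i, ‖T k ν i * (R₀ k ν i)⁻¹ - 1‖ < 1) : expChartT P R₀ (logChartT P R₀ T) = T :=
  expChartT_logChartT P (isUnit_det_of_unitary P hR) hT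

/-- [folklore] `logChartT_expChartT` at a unitary centre: the literal window `‖A k ν i‖ < log 2`. -/
theorem logChartT_expChartT_of_unitary {R₀ A : TowerData P o} (hR : ∀ (k : Fin (P.K + 1)) ν i, R₀ k ν i ∈ Matrix.unitaryGroup o ℂ)
    (hA : ∀ (k : Fin (P.K + 1)) ν i, ‖A k ν i‖ < Real.log 2) : logChartT P R₀ (expChartT P R₀ A) = A :=
  logChartT_expChartT P (isUnit_det_of_unitary P hR) hA

/-! ### The log window from a sup-norm ball at a UNITARY centre (what a depth-control letter consumes) -/
/-- [folklore] The inverse of a unitary matrix has L2-operator norm `≤ 1` (`= 1` when `o` is nonempty: `CStarRing.norm_of_mem_unitary`). -/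
theorem norm_inv_le_one_of_mem_unitaryGroup {U : Matrix o o ℂ} (hU : U ∈ Matrix.unitaryGroup o ℂ) : ‖U⁻¹‖ ≤ 1 := by
  rcases isEmpty_or_nonempty o with ho | ho
  · rw [Subsingleton.elim U⁻¹ 0, norm_zero]; exact zero_le_one
  · have hinv : U⁻¹ = star U := Matrix.inv_eq_left_inv (Matrix.mem_unitaryGroup_iff'.1 hU)
    rw [hinv]
    exact (CStarRing.norm_of_mem_unitary (Unitary.star_mem hU)).le

/-- [folklore] **RELATIVE vs ABSOLUTE DISTANCE AT A UNITARY TRANSPORTER**: `‖T·U⁻¹ − 1‖ ≤ ‖T − U‖` (`T·U⁻¹ − 1 = (T − U)·U⁻¹`, `‖U⁻¹‖ ≤ 1`). -/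
theorem norm_mul_inv_sub_one_le {U : Matrix o o ℂ} (hU : U ∈ Matrix.unitaryGroup o ℂ) (T : Matrix o o ℂ) : ‖T * U⁻¹ - 1‖ ≤ ‖T - U‖ := by
  have h1 : T * U⁻¹ - 1 = (T - U) * U⁻¹ := by rw [sub_mul, Matrix.mul_nonsing_inv _ (isUnit_det_of_mem_unitaryGroup hU)]
  rw [h1]
  calc ‖(T - U) * U⁻¹‖ ≤ ‖T - U‖ * ‖U⁻¹‖ := norm_mul_le _ _
    _ ≤ ‖T - U‖ * 1 := mul_le_mul_of_nonneg_left (norm_inv_le_one_of_mem_unitaryGroup hU) (norm_nonneg _)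
    _ = ‖T - U‖ := mul_one _

/-- [folklore] Entrywise: the relative distance of a tower to a unitary centre is bounded by the Pi-sup distance `‖T − R₀‖`. -/
theorem norm_entry_mul_inv_sub_one_le {R₀ : TowerData P o} (hR : ∀ (k : Fin (P.K + 1)) ν i, R₀ k ν i ∈ Matrix.unitaryGroup o ℂ)
    (T : TowerData P o) (k : Fin (P.K + 1)) (ν : Fin P.d) (i : Tor (fine (lev P.L k) (unitMod P)) × Fin P.d) :
    ‖T k ν i * (R₀ k ν i)⁻¹ - 1‖ ≤ ‖T - R₀‖ :=
  calc ‖T k ν i * (R₀ k ν i)⁻¹ - 1‖ ≤ ‖T k ν i - R₀ k ν i‖ := norm_mul_inv_sub_one_le (hR k ν i) _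
    _ = ‖(T - R₀) k ν i‖ := by rw [Pi.sub_apply, Pi.sub_apply, Pi.sub_apply]
    _ ≤ ‖(T - R₀) k ν‖ := norm_le_pi_norm _ i
    _ ≤ ‖(T - R₀) k‖ := norm_le_pi_norm _ ν
    _ ≤ ‖T - R₀‖ := norm_le_pi_norm _ k

/-- [folklore] **THE SUP-NORM UNIT BALL AT A UNITARY CENTRE LIES IN ITS LOG WINDOW**: `‖T − R₀‖ < 1 ⇒ ∀ k ν i, ‖T k ν i·(R₀ k ν i)⁻¹ − 1‖ < 1`
— so `expChartT_logChartT`, `analyticAt_logChartT` apply on `Metric.ball R₀ 1`. -/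
theorem mem_logWindow_of_norm_sub_lt_one {R₀ : TowerData P o} (hR : ∀ (k : Fin (P.K + 1)) ν i, R₀ k ν i ∈ Matrix.unitaryGroup o ℂ)
    {T : TowerData P o} (hT : ‖T - R₀‖ < 1) (k : Fin (P.K + 1)) (ν : Fin P.d) (i : Tor (fine (lev P.L k) (unitMod P)) × Fin P.d) :
    ‖T k ν i * (R₀ k ν i)⁻¹ - 1‖ < 1 :=
  (norm_entry_mul_inv_sub_one_le P hR T k ν i).trans_lt hT

/-- [folklore] **DEPTH CONTROL OF THE LOG CHART ON THE HALF BALL**: at a unitary centre, `‖T − R₀‖ ≤ 1∕2 ⇒ ‖logChartT P R₀ T‖ ≤ 2·‖T − R₀‖`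
(the quantitative letter a `MapsTo (logChartT P R₀ ∘ slice) (closedBall 0 1) (ball 0 ϱ)`-type clause consumes). -/
theorem norm_logChartT_le_two_mul_norm_sub {R₀ : TowerData P o} (hR : ∀ (k : Fin (P.K + 1)) ν i, R₀ k ν i ∈ Matrix.unitaryGroup o ℂ)
    {T : TowerData P o} (hT : ‖T - R₀‖ ≤ 1 / 2) : ‖logChartT P R₀ T‖ ≤ 2 * ‖T - R₀‖ :=
  norm_logChartT_le P (norm_nonneg _) hT fun k ν i => norm_entry_mul_inv_sub_one_le P hR T k ν i

/-- [folklore] … and the log chart of a unitary centre is analytic on the whole sup-norm unit ball around it. -/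
theorem analyticOnNhd_logChartT_ball {R₀ : TowerData P o} (hR : ∀ (k : Fin (P.K + 1)) ν i, R₀ k ν i ∈ Matrix.unitaryGroup o ℂ) :
    AnalyticOnNhd ℂ (fun T : TowerData P o => logChartT P R₀ T) (Metric.ball R₀ 1) := fun _ hT =>
  analyticAt_logChartT P (mem_logWindow_of_norm_sub_lt_one P hR (mem_ball_iff_norm.1 hT))

end Tower

end Summit.QuantumFields.BalabanUV.T4Continuum.SubstrateExpChartLog

end
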